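import Summits.HubbardSuperconductivity.HubbardLadder.DWaveFormFactorSumUniform
import HarnessLib

/-!
# Lower Riemann sums for the `d`-wave form factor: `Φ_L ≥ 8L²/π² − 6L`

pub-hubbard r3 — part 1 of 3 of the SHARPNESS complement to rung 0′ of the R4 ceiling ladder (R4-MEMO
§9.13; parts: this file → `DWavePairFieldKinematicWitness` → `DWavePairFieldKinematicCeilingSharp`).
HONEST FRAMING: ladder R1–R4 with certified numbers; no claim on H/H₀. NEW cell-side mathematics (not a
published result), staged by the r3 planner seat for a prover/librarian seat. KINEMATIC CALIBRATION ONLY —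
not a booked rung, ladder tallies unchanged, no numerics (imports only the landed
`DWaveFormFactorSumUniform`).

CONTENT. The companion LOWER bounds to the tree's upper Riemann bounds (`sum_absSinZMod_le`,
`sum_abs_dWaveGap_le_uniform : Φ_L ≤ 8L²/π² + 8L/π`): `Σ_{n<L} sin(πn/L) ≥ 2L/π − 1` (`sum_sin_ge`,
`sum_absSinZMod_ge`; concavity is not needed — each unit cell loses at most `(π/L)·1` against the integral
since `|sin|` is 1-Lipschitz), `Σ_{a<L} |sin(2πa/L − θ)| ≥ 2L/π − π` for every phase (`sum_abs_sin_ge`,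
`sum_absSinZMod_two_mul_sub_ge`), hence with the tree's product formula
`|cos k₁ − cos k₂| = 2|sin((k₁+k₂)/2)|·|sin((k₁−k₂)/2)|` and the bijection-free double sum
**`sum_abs_dWaveGap_ge : 8L²/π² − 6L ≤ Φ_L = Σ_k |ĝ_d(k)|`** and the two-sided
`abs_sum_abs_dWaveGap_sub_le : |Φ_L − 8L²/π²| ≤ 6L`, i.e. `Φ_L/L² → 8/π²`. Used by part 2 to show that the
kinematic `d`-wave ceiling `128/π⁴ = 2·(8/π²)²` is attained. Everything is proved here from Mathlib and the
tree's definitions; no published theorem is cited as a fact. [folklore]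
-/

noncomputable section

namespace Summit.HubbardSuperconductivity.HubbardLadder

open Matrix Finset Literature.Probability.LatticeModels Literature.MathematicalPhysics.QuantumLattice
open scoped ComplexOrder ComplexConjugate

variable {L : ℕ} [NeZero L]

/-! ### §1 Lower Riemann bounds and `Φ_L ≥ 8L²/π² − 6L` -/

/-- The representatives `s.val`, `s ∈ ℤ/Lℤ`, are exactly `0, …, L − 1`. [folklore] -/
theorem image_val_univ : (univ : Finset (ZMod L)).image ZMod.val = range L := by
  refine Finset.eq_of_subset_of_card_le (fun n hn => ?_) ?_
  · obtain ⟨s, _, rfl⟩ := Finset.mem_image.1 hn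
    exact Finset.mem_range.2 (ZMod.val_lt s)
  · rw [Finset.card_image_of_injective _ (ZMod.val_injective L), Finset.card_univ, ZMod.card,
      Finset.card_range]

/-- `Σ_{n<L} sin(πn/L) ≥ 2L/π − 1` (`= cot(π/2L)` by `sum_sin_mul_sin_half`; `sin x ≤ x`,
`cos x ≥ 1 − x²/2`). [folklore] -/
theorem sum_sin_ge (L : ℕ) (hL : L ≠ 0) :
    2 * L / Real.pi - 1 ≤ ∑ n ∈ range L, Real.sin (Real.pi * n / L) := by
  have hpi := Real.pi_pos
  have hLpos : (0 : ℝ) < L := by exact_mod_cast Nat.pos_of_ne_zero hL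
  have hL1 : (1 : ℝ) ≤ L := by exact_mod_cast Nat.one_le_iff_ne_zero.2 hL
  set x : ℝ := Real.pi / (2 * L) with hx
  have hx0 : 0 < x := by positivity
  have hxle : x ≤ 2 := by
    rw [hx, div_le_iff₀ (by positivity)]
    nlinarith [Real.pi_le_four]
  set S := ∑ n ∈ range L, Real.sin (Real.pi * n / L) with hS
  have hS0 : 0 ≤ S := by
    refine Finset.sum_nonneg fun n hn => Real.sin_nonneg_of_nonneg_of_le_pi (by positivity) ?_
    have hn' : (n : ℝ) ≤ L := by exact_mod_cast (Finset.mem_range.1 hn).le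
    rw [div_le_iff₀ hLpos]
    nlinarith
  have hid : S * Real.sin x = Real.cos x := sum_sin_mul_sin_half L hL
  have hsin : Real.sin x ≤ x := Real.sin_le hx0.le
  have hcos : 1 - x ^ 2 / 2 ≤ Real.cos x := Real.one_sub_sq_div_two_le_cos
  have h1 : (2 * L / Real.pi - 1) * x = 1 - x := by
    rw [hx]
    field_simp
  have h2 : 1 - x ≤ S * x :=
    calc 1 - x ≤ 1 - x ^ 2 / 2 := by nlinarith
      _ ≤ Real.cos x := hcos
      _ = S * Real.sin x := hid.symm
      _ ≤ S * x := mul_le_mul_of_nonneg_left hsin hS0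
  rw [← h1] at h2
  exact le_of_mul_le_mul_right h2 hx0

/-- `Σ_{s ∈ ℤ/Lℤ} g(s) ≥ 2L/π − 1`. [folklore] -/
theorem sum_absSinZMod_ge : 2 * L / Real.pi - 1 ≤ ∑ s : ZMod L, absSinZMod s := by
  have hL : (L : ℕ) ≠ 0 := NeZero.ne L
  have hLpos : (0 : ℝ) < L := by exact_mod_cast Nat.pos_of_ne_zero hL
  have h1 : ∑ s : ZMod L, absSinZMod s = ∑ n ∈ range L, absSinZ L (n : ℤ) := by
    rw [← image_val_univ (L := L), Finset.sum_image fun a _ b _ h => ZMod.val_injective L h]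
    rfl
  have h3 : ∑ n ∈ range L, absSinZ L (n : ℤ) = ∑ n ∈ range L, Real.sin (Real.pi * n / L) := by
    refine Finset.sum_congr rfl fun n hn => ?_
    rw [absSinZ, Int.cast_natCast, abs_of_nonneg]
    refine Real.sin_nonneg_of_nonneg_of_le_pi (by positivity) ?_
    have hn' : (n : ℝ) ≤ L := by exact_mod_cast (Finset.mem_range.1 hn).le
    rw [div_le_iff₀ hLpos]
    nlinarith [Real.pi_pos]
  rw [h1, h3]
  exact sum_sin_ge L hL

/-- **Lower Riemann bound**: `Σ_{a<L} |sin(2πa/L − θ)| ≥ 2L/π − π` for every real `θ`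
(`|sin t| ≤ |sin x_a| + π/L` on the interval of length `2π/L` centred at the node `x_a = 2πa/L − θ`;
these intervals tile one period, over which `∫ |sin| = 4`). [folklore] -/
theorem sum_abs_sin_ge (L : ℕ) (hL : L ≠ 0) (θ : ℝ) :
    2 * L / Real.pi - Real.pi ≤ ∑ a ∈ range L, |Real.sin (2 * Real.pi * a / L - θ)| := by
  have hLpos : (0 : ℝ) < L := by exact_mod_cast Nat.pos_of_ne_zero hL
  have hL' : (L : ℝ) ≠ 0 := hLpos.ne'
  have hpi := Real.pi_pos
  set y : ℕ → ℝ := fun j => 2 * Real.pi * j / L - θ - Real.pi / L with hy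
  have hya : ∀ a : ℕ, y a = (2 * Real.pi * a / L - θ) - Real.pi / L := fun a => rfl
  have hyb : ∀ a : ℕ, y (a + 1) = (2 * Real.pi * a / L - θ) + Real.pi / L := by
    intro a; simp only [hy]; push_cast; field_simp; ring
  have hlen : ∀ a : ℕ, y (a + 1) - y a = 2 * Real.pi / L := by
    intro a; rw [hyb, hya]; ring
  have hle : ∀ a : ℕ, y a ≤ y (a + 1) := fun a => by
    rw [hyb, hya]
    have : 0 < Real.pi / L := by positivity
    linarith
  -- the Lipschitz bound on each interval
  have hpt : ∀ a : ℕ, ∀ t ∈ Set.Icc (y a) (y (a + 1)),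
      |Real.sin t| ≤ |Real.sin (2 * Real.pi * a / L - θ)| + Real.pi / L := by
    intro a t ht
    have hlo := ht.1
    have hhi := ht.2
    rw [hya] at hlo
    rw [hyb] at hhi
    have hc : |t - (2 * Real.pi * a / L - θ)| ≤ Real.pi / L := by
      rw [abs_le]; constructor <;> linarith
    have hlip := Real.abs_sin_sub_sin_le t (2 * Real.pi * a / L - θ)
    have htri := abs_sub_abs_le_abs_sub (Real.sin t) (Real.sin (2 * Real.pi * a / L - θ))
    linarith
  have hint : ∀ a : ℕ, ∫ t in y a..y (a + 1), |Real.sin t| ≤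
      2 * Real.pi / L * (|Real.sin (2 * Real.pi * a / L - θ)| + Real.pi / L) := by
    intro a
    have hmono : (∫ t in y a..y (a + 1), |Real.sin t|) ≤
        ∫ _ in y a..y (a + 1), (|Real.sin (2 * Real.pi * a / L - θ)| + Real.pi / L) :=
      intervalIntegral.integral_mono_on (hle a)
        (Real.continuous_sin.abs.intervalIntegrable _ _) (continuous_const.intervalIntegrable _ _) (hpt a)
    rw [intervalIntegral.integral_const, smul_eq_mul, hlen a] at hmono
    exact hmono
  have hadj : ∑ a ∈ range L, ∫ t in y a..y (a + 1), |Real.sin t| = ∫ t in y 0..y L, |Real.sin t| :=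
    intervalIntegral.sum_integral_adjacent_intervals fun k _ =>
      Real.continuous_sin.abs.intervalIntegrable _ _
  have hper : y L = y 0 + 2 * Real.pi := by
    simp only [hy]; push_cast; field_simp; ring
  have h4 : (4 : ℝ) ≤ 2 * Real.pi / L *
      ((∑ a ∈ range L, |Real.sin (2 * Real.pi * a / L - θ)|) + L * (Real.pi / L)) :=
    calc (4 : ℝ) = ∫ t in y 0..y L, |Real.sin t| := by rw [hper, integral_abs_sin_period]
      _ = ∑ a ∈ range L, ∫ t in y a..y (a + 1), |Real.sin t| := hadj.symm
      _ ≤ ∑ a ∈ range L, 2 * Real.pi / L * (|Real.sin (2 * Real.pi * a / L - θ)| + Real.pi / L) :=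
          Finset.sum_le_sum fun a _ => hint a
      _ = 2 * Real.pi / L *
          ((∑ a ∈ range L, |Real.sin (2 * Real.pi * a / L - θ)|) + L * (Real.pi / L)) := by
          rw [← Finset.mul_sum, Finset.sum_add_distrib, Finset.sum_const, Finset.card_range, nsmul_eq_mul]
  have hLpi : (L : ℝ) * (Real.pi / L) = Real.pi := by field_simp
  rw [hLpi, div_mul_eq_mul_div, le_div_iff₀ hLpos] at h4
  rw [sub_le_iff_le_add, div_le_iff₀ hpi]
  linarith

/-- `(2a-s).val ≡ 2·a.val - s.val (mod L)`. -/
private theorem dvd_val_two_mul_sub' (a s : ZMod L) :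
    (L : ℤ) ∣ ((2 * a - s).val : ℤ) - (2 * (a.val : ℤ) - s.val) := by
  rw [← ZMod.intCast_zmod_eq_zero_iff_dvd]
  push_cast
  rw [ZMod.natCast_zmod_val, ZMod.natCast_zmod_val, ZMod.natCast_zmod_val, sub_self]

/-- `Σ_{a ∈ ℤ/Lℤ} g(2a − s) ≥ 2L/π − π` for every `s` and every `L ≥ 1`. [folklore] -/
theorem sum_absSinZMod_two_mul_sub_ge (s : ZMod L) :
    2 * L / Real.pi - Real.pi ≤ ∑ a : ZMod L, absSinZMod (2 * a - s) := by
  have hL : (L : ℕ) ≠ 0 := NeZero.ne L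
  have hcong : ∀ a : ZMod L, absSinZMod (2 * a - s) = absSinZ L (2 * (a.val : ℤ) - s.val) :=
    fun a => absSinZ_eq_of_dvd hL (dvd_val_two_mul_sub' a s)
  have h1 : ∑ a : ZMod L, absSinZMod (2 * a - s) =
      ∑ n ∈ range L, absSinZ L (2 * (n : ℤ) - s.val) := by
    rw [← image_val_univ (L := L), Finset.sum_image fun a _ b _ h => ZMod.val_injective L h]
    exact Finset.sum_congr rfl fun a _ => hcong a
  have h3 : ∑ n ∈ range L, absSinZ L (2 * (n : ℤ) - s.val) =
      ∑ n ∈ range L, |Real.sin (2 * Real.pi * n / L - Real.pi * s.val / L)| := by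
    refine Finset.sum_congr rfl fun n _ => ?_
    rw [absSinZ]
    congr 2
    push_cast
    ring
  rw [h1, h3]
  exact sum_abs_sin_ge L hL _

/-- **`Φ_L ≥ 8L²/π² − 6L` for every `L ≥ 1`**: with `|ĝ_d(k)| = 2 g(k₁+k₂) g(k₁−k₂)`, the reindexing
`b ↦ a + b` and the two lower Riemann bounds, `Φ_L = Σ_s 2g(s) Σ_a g(2a−s) ≥ 2(2L/π − π)(2L/π − 1)`.
[folklore] -/
theorem sum_abs_dWaveGap_ge :
    8 * (L : ℝ) ^ 2 / Real.pi ^ 2 - 6 * L ≤ ∑ k : TorusSite 2 L, |dWaveGap k| := by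
  have hpi := Real.pi_pos
  have hpi3 := Real.pi_gt_three
  have hL : (L : ℕ) ≠ 0 := NeZero.ne L
  have hLpos : (0 : ℝ) < L := by exact_mod_cast Nat.pos_of_ne_zero hL
  have h1 : ∑ k : TorusSite 2 L, |dWaveGap k| =
      ∑ p : ZMod L × ZMod L, 2 * absSinZMod (p.1 + p.2) * absSinZMod (p.1 - p.2) := by
    refine Fintype.sum_equiv (finTwoArrowEquiv (ZMod L)) _ _ fun k => ?_
    rw [abs_dWaveGap_eq]
    rfl
  have h3 : ∀ a : ZMod L, ∑ b : ZMod L, 2 * absSinZMod (a + b) * absSinZMod (a - b) =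
      ∑ s : ZMod L, 2 * absSinZMod s * absSinZMod (2 * a - s) := by
    intro a
    refine Fintype.sum_equiv (Equiv.addLeft a) _ _ fun b => ?_
    simp only [Equiv.coe_addLeft]
    congr 2
    ring
  have hΦ : ∑ k : TorusSite 2 L, |dWaveGap k| =
      ∑ s : ZMod L, 2 * absSinZMod s * ∑ a : ZMod L, absSinZMod (2 * a - s) :=
    calc ∑ k : TorusSite 2 L, |dWaveGap k|
        = ∑ a : ZMod L, ∑ b : ZMod L, 2 * absSinZMod (a + b) * absSinZMod (a - b) := by
          rw [h1, Fintype.sum_prod_type]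
      _ = ∑ a : ZMod L, ∑ s : ZMod L, 2 * absSinZMod s * absSinZMod (2 * a - s) :=
          Finset.sum_congr rfl fun a _ => h3 a
      _ = ∑ s : ZMod L, 2 * absSinZMod s * ∑ a : ZMod L, absSinZMod (2 * a - s) := by
          rw [Finset.sum_comm]
          refine Finset.sum_congr rfl fun s _ => ?_
          rw [Finset.mul_sum]
  have hS := sum_absSinZMod_ge (L := L)
  have hS0 : 0 ≤ ∑ s : ZMod L, absSinZMod s := Finset.sum_nonneg fun s _ => absSinZMod_nonneg s
  have hΦ0 : 0 ≤ ∑ k : TorusSite 2 L, |dWaveGap k| := Finset.sum_nonneg fun k _ => abs_nonneg _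
  by_cases hα : 0 ≤ 2 * L / Real.pi - Real.pi
  · have hM : ∀ s : ZMod L, 2 * absSinZMod s * (2 * L / Real.pi - Real.pi) ≤
        2 * absSinZMod s * ∑ a : ZMod L, absSinZMod (2 * a - s) := fun s =>
      mul_le_mul_of_nonneg_left (sum_absSinZMod_two_mul_sub_ge s)
        (mul_nonneg zero_le_two (absSinZMod_nonneg s))
    have e : 2 * (2 * L / Real.pi - Real.pi) * (2 * L / Real.pi - 1) =
        8 * (L : ℝ) ^ 2 / Real.pi ^ 2 - 4 * L / Real.pi - 4 * L + 2 * Real.pi := by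
      field_simp
      ring
    have h43 : 4 * (L : ℝ) / Real.pi ≤ 4 * L / 3 :=
      div_le_div_of_nonneg_left (by positivity) (by norm_num) hpi3.le
    calc 8 * (L : ℝ) ^ 2 / Real.pi ^ 2 - 6 * L
        ≤ 2 * (2 * L / Real.pi - Real.pi) * (2 * L / Real.pi - 1) := by rw [e]; linarith
      _ ≤ 2 * (2 * L / Real.pi - Real.pi) * ∑ s : ZMod L, absSinZMod s :=
          mul_le_mul_of_nonneg_left hS (mul_nonneg zero_le_two hα)
      _ = ∑ s : ZMod L, 2 * absSinZMod s * (2 * L / Real.pi - Real.pi) := by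
          rw [Finset.mul_sum]
          exact Finset.sum_congr rfl fun s _ => by ring
      _ ≤ ∑ s : ZMod L, 2 * absSinZMod s * ∑ a : ZMod L, absSinZMod (2 * a - s) :=
          Finset.sum_le_sum fun s _ => hM s
      _ = ∑ k : TorusSite 2 L, |dWaveGap k| := hΦ.symm
  · -- `2L < π²`: the left side is negative
    rw [not_le] at hα
    have hLlt : 2 * (L : ℝ) < Real.pi * Real.pi := by
      have h := hα
      rw [sub_neg, div_lt_iff₀ hpi] at h
      linarith
    have h8 : 8 * (L : ℝ) ^ 2 < 6 * L * Real.pi ^ 2 := by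
      have h' := mul_lt_mul_of_pos_left hLlt (by positivity : (0 : ℝ) < 4 * L)
      nlinarith
    have : 8 * (L : ℝ) ^ 2 / Real.pi ^ 2 < 6 * L := by
      rw [div_lt_iff₀ (by positivity)]
      exact h8
    linarith

/-- With the uniform upper bound: `|Φ_L − 8L²/π²| ≤ 6L`, i.e. `Φ_L/L² → 8/π²` at rate `1/L`. [folklore] -/
theorem abs_sum_abs_dWaveGap_sub_le :
    |∑ k : TorusSite 2 L, |dWaveGap k| - 8 * (L : ℝ) ^ 2 / Real.pi ^ 2| ≤ 6 * (L : ℝ) := by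
  have hlo := sum_abs_dWaveGap_ge (L := L)
  have hhi := sum_abs_dWaveGap_le_uniform (L := L)
  have hpi3 := Real.pi_gt_three
  have hL : (L : ℕ) ≠ 0 := NeZero.ne L
  have hLpos : (0 : ℝ) < L := by exact_mod_cast Nat.pos_of_ne_zero hL
  have h83 : 8 * (L : ℝ) / Real.pi ≤ 8 * L / 3 :=
    div_le_div_of_nonneg_left (by positivity) (by norm_num) hpi3.le
  rw [abs_le]
  constructor <;> linarith

end Summit.HubbardSuperconductivity.HubbardLadder
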